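import Summits.QuantumFields.BalabanUV.Beta.CombMixedT2EvenStoreyTwoTorusRow
import Summits.QuantumFields.BalabanUV.Beta.CombMixedT2EvenStoreyTorusRow
import Summits.QuantumFields.BalabanUV.Beta.CombHessStoreySplitTorus
import Summits.QuantumFields.BalabanUV.Beta.FP.TowerK2bStoreyBridge

/-!
# `BalabanUV.Beta.FP.TowerK2bStoreyBridgeTwo` — road «FP», binder row D1, ROUTE T (β1): **THE WARD DEFECT OF THE END WRAPPER AT ITS FIRST COMPOSITE DEPTH, IN CLOSED
# FORM, AND THE SUCCESSOR STEP AT EVERY DEPTH** — at depth 2 (v5…v8's boxes `n = 0`), for the even composite mixed table `ℳ̂₂ᵉ` and the composite constraint Hessian `Ĉ = compH … 2`, any box `M = Lc²·M′`, any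
# torus gauge function `λ`: `Σ_b (Dλ)_b • ℳ̂₂ᵉ(b; ρ′,w)|ff = (−wM2) • (E_λ·Ĉ_{ρ′,w} − Ĉ_{ρ′,w}·E_λ) + Σ_s λ s • Rs s` with the EXPLICIT site-remainder
# `Rs s = wM2 • Σ_{κ₁e₁κ₂e₂} h(ρ′,w;b₁,b₂) • ((𝟙[·.1 = s] − 𝟙[ŵ(root b₁) = s])·L̃_{b₁} ⊗ L̃_{b₂} − L̃_{b₁} ⊗ (𝟙[·.1 = s] − 𝟙[ŵ(root b₂) = s])·L̃_{b₂})` — i.e. the wrapper's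
# defect `Def(λ; ρ′,w) = wM2 • Σ h • (D_λ(b₁) ⊗ L̃(b₂) − L̃(b₁) ⊗ D_λ(b₂))`, `D_λ(b;x) = L̃(b;x)·(λ(x.1) − λ(ŵ(root b)))` (the transport-variation word)

WHY (`g47/SPEC-59.md` §2; journal [D1P3-G47-K2LC]).  an2 PART 31d `CombMixedT2EvenStoreyTwoTorusRow.torus_compM2even_pureGauge_fst_fun` gives the row STOREYWISE; PART 34
`CombHessStoreySplitTorus.perF_dper_compH_two_ff` splits `Ĉ` by storeys; the road's generic `TowerK2bStoreyBridge.storeyRow_eq_commutator_add_remainder_window` turns the pair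
into the wrapper's currency (§1 `def_depthTwo`); §2 `def_succ` is the same one composite up with the LOWER rows as hypotheses (an2 PART 33c
`torus_compM2even_pureGauge_fst_fun_succ` + PART 34 `perF_dper_compH_succ_ff`) — iterate for every box of v8.  This is the K-bridge at n = 0 (leaf-03 g60 K-BRIDGES): v8's displayed residual row (J-R₂″) contracts exactly THIS `Def` — by value NOT zero at the
road's read-outs (Engine C K2L-C), the located law-level question Q-FP-47-1.  [folklore] composition BY NAME; no `def`, no `def … : Prop`, nothing cited, 0 sorry.
Nothing of Bałaban's asserted, valued or discharged; 0 estimates; 0∕4 row-D1 binders (hW, hR, D1Tel, D1Rep); NOT (C1), NOT (T-ID), NOT D1, NOT BetaPertH, NOT continuum, NOT Clay.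

HONEST DEPENDENCY (page 1, mandatory): continuum YM on T⁴ ⇐ BetaPertH ∧ nine spine estimates (0/9 proved); BetaPertH ⇐ (D1) ∧ (D4) ∧ CAP+tail;
G-an2-4 gates asym, D1 and NE2/3/4.  HONEST FRAMING (cell contract, verbatim): «discharging `BetaPertH` makes Bałaban's UV stability UNCONDITIONAL —
a real constructive-QFT result; it is NOT the continuum limit and NOT the Clay problem.»  ABSOLUTE RULE (cell charter, verbatim): «No internally-minted
statement may enter as a cited fact. Every hypothesis is either kernel-proved in this package or a verbatim quotation of a PUBLISHED theorem with page
reference. The manuscript(s) under audit are NOT citable for their own disputed steps — they are the thing under adjudication; programme-internal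
(2001/route/tribunal) claims are never citable.»  Road «FP» OWNER, b2b-balaban-beta-d1-p3 gen 47, 2026-08-28.  No existing file touched.
-/

noncomputable section

open scoped BigOperators

namespace Summit.QuantumFields.BalabanUV.Beta.FP.TowerK2bStoreyBridgeTwo

open Finset Matrix
open Literature.MathematicalPhysics.QuantumFieldTheory
open Literature.MathematicalPhysics.QuantumFieldTheory.Balaban1983to89
open Literature.MathematicalPhysics.QuantumFieldTheory.Balaban1983to89.Beta
open B4TorusKernel.MultiPeriod (translate)
open B6Lemma24Torus (pbox)
open ExpKernelCalculus (MKer)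
open AffineAveraging (Site)
open AveragingContoursRooted (ctr ctrOff)
open OneStepResolventKernel (Fib)
open BalabanStepW2 (M2Of wM2)
open Summit.QuantumFields.BalabanUV.Beta.TameKernelCalculus (trK)
open Summit.QuantumFields.BalabanUV.Beta.BorderedHessian (sgnK)
open Summit.QuantumFields.BalabanUV.Beta.SymAveragingHessianCounts (symLinKerAt symHessKerAt symHessFFAt)
open Summit.QuantumFields.BalabanUV.Beta.CompositeVertexKernelRec (offs)
open Summit.QuantumFields.BalabanUV.Beta.CompositeOneShotJets (compMix compH)
open Summit.QuantumFields.BalabanUV.Beta.FP.KernelPeriodisationFib (Idx perF)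
open Summit.QuantumFields.BalabanUV.Beta.FP.KernelPeriodisationFibLoc (dper)
open Summit.QuantumFields.BalabanUV.Beta.FP.TorusGaugeCovariance (tgrad)
open Summit.QuantumFields.BalabanUV.Beta.FP.TorusGaugeCovariancePairing (wrapPt)
open Summit.QuantumFields.BalabanUV.Beta.CombMixedT2EvenStoreyTwoTorusRow (torus_compM2even_pureGauge_fst_fun)
open Summit.QuantumFields.BalabanUV.Beta.CombMixedT2EvenStoreyTorusRow (torus_compM2even_pureGauge_fst_fun_succ)
open Summit.QuantumFields.BalabanUV.Beta.CompositeVertexKernelRec (compLinKer)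
open Summit.QuantumFields.BalabanUV.Beta.CombHessStoreySplitTorus (perF_dper_compH_two_ff perF_dper_compH_succ_ff)
open Summit.QuantumFields.BalabanUV.Beta.FP.TowerK2bStoreyBridge (storeyRow_eq_commutator_add_remainder_window)

variable {Lc : ℕ} [NeZero Lc]

section DepthTwo

variable {M M' : Fin (3 + 1) → ℕ} [∀ μ, NeZero (M μ)] [∀ μ, NeZero (M' μ)] (L₂ j : ℕ) (ρ' : Fin (3 + 1)) (w : Site (3 + 1))
  {V : Fin (3 + 1) → Site (3 + 1) → MKer (3 + 1) (Fib 3)}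

/-- [folklore] **`def_depthTwo` — THE END WRAPPER's (K2b) SHAPE AT DEPTH 2 WITH ITS REMAINDER IN CLOSED FORM**: an2 PART 31d's storeywise row + PART 34's storey split,
through the road's window bridge: `Σ_b (Dλ)_b • ℳ̂₂ᵉ(b)|ff = (−wM2) • (E_λ·Ĉ − Ĉ·E_λ) + Σ_s λ s • Rs s`, `Rs` = the transport-variation word on either leg of the top brick. -/
theorem def_depthTwo (hM : ∀ i, M i = Lc ^ 2 * M' i)
    (hV : V = fun κ u x z a c => ∑' n : Site (3 + 1),
      ((1 / 2 : ℝ) • (M2Of 3 L₂ (compMix (ctrOff (3 + 1) Lc) Lc 2) j κ u ρ' (translate M' w n)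
          + sgnK (trK (M2Of 3 L₂ (compMix (ctrOff (3 + 1) Lc) Lc 2) j κ u ρ' (translate M' w n))))) x z a c)
    (lam : ↥(pbox M) → ℝ) :
    (∑ b : ↥(pbox M) × Fin (3 + 1), (∑ s : ↥(pbox M), tgrad M (b.1, Sum.inl b.2) s * lam s) •
        (perF M (dper M (V b.2 (b.1 : Site (3 + 1))))).submatrix
          (fun b : ↥(pbox M) × Fin (3 + 1) => ((b.1, Sum.inl b.2) : Idx M (Fib 3)))
          (fun b : ↥(pbox M) × Fin (3 + 1) => ((b.1, Sum.inl b.2) : Idx M (Fib 3))))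
      = (-(wM2 3 L₂ j)) • (Matrix.diagonal (fun b : ↥(pbox M) × Fin (3 + 1) => lam b.1)
            * (perF M (dper M (compH (ctrOff (3 + 1) Lc) Lc 2 ρ' w))).submatrix
                (fun b : ↥(pbox M) × Fin (3 + 1) => ((b.1, Sum.inl b.2) : Idx M (Fib 3)))
                (fun b : ↥(pbox M) × Fin (3 + 1) => ((b.1, Sum.inl b.2) : Idx M (Fib 3)))
          - (perF M (dper M (compH (ctrOff (3 + 1) Lc) Lc 2 ρ' w))).submatrix
                (fun b : ↥(pbox M) × Fin (3 + 1) => ((b.1, Sum.inl b.2) : Idx M (Fib 3)))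
                (fun b : ↥(pbox M) × Fin (3 + 1) => ((b.1, Sum.inl b.2) : Idx M (Fib 3)))
            * Matrix.diagonal (fun b : ↥(pbox M) × Fin (3 + 1) => lam b.1))
        + ∑ s : ↥(pbox M), lam s • (wM2 3 L₂ j • ∑ κ₁ : Fin (3 + 1), ∑ e₁ ∈ offs Lc, ∑ κ₂ : Fin (3 + 1), ∑ e₂ ∈ offs Lc,
            symHessKerAt (ctr 4 Lc) Lc ρ' w (κ₁, (Lc : ℤ) • w + e₁) (κ₂, (Lc : ℤ) • w + e₂) •
              (Matrix.vecMulVec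
                  (fun x : ↥(pbox M) × Fin (3 + 1) => ((if x.1 = s then (1 : ℝ) else 0) - (if wrapPt M ((Lc : ℤ) • ((Lc : ℤ) • w + e₁) + ctr 4 Lc) = s then (1 : ℝ) else 0))
                    * ∑' n : Site (3 + 1), symLinKerAt (ctr 4 Lc) Lc κ₁ ((Lc : ℤ) • w + e₁) (x.2, translate M (x.1 : Site (3 + 1)) n))
                  (fun z : ↥(pbox M) × Fin (3 + 1) => ∑' n : Site (3 + 1), symLinKerAt (ctr 4 Lc) Lc κ₂ ((Lc : ℤ) • w + e₂) (z.2, translate M (z.1 : Site (3 + 1)) n))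
                - Matrix.vecMulVec
                  (fun x : ↥(pbox M) × Fin (3 + 1) => ∑' n : Site (3 + 1), symLinKerAt (ctr 4 Lc) Lc κ₁ ((Lc : ℤ) • w + e₁) (x.2, translate M (x.1 : Site (3 + 1)) n))
                  (fun z : ↥(pbox M) × Fin (3 + 1) => ((if z.1 = s then (1 : ℝ) else 0) - (if wrapPt M ((Lc : ℤ) • ((Lc : ℤ) • w + e₂) + ctr 4 Lc) = s then (1 : ℝ) else 0))
                    * ∑' n : Site (3 + 1), symLinKerAt (ctr 4 Lc) Lc κ₂ ((Lc : ℤ) • w + e₂) (z.2, translate M (z.1 : Site (3 + 1)) n)))) := by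
  rw [torus_compM2even_pureGauge_fst_fun L₂ j ρ' w hM hV lam]
  have key := storeyRow_eq_commutator_add_remainder_window (ι := ↥(pbox M) × Fin (3 + 1)) (σ := ↥(pbox M)) (K := Fin (3 + 1)) (offs Lc)
    (fun x : ↥(pbox M) × Fin (3 + 1) => x.1) lam
    (fun κ₁ e₁ κ₂ e₂ => symHessKerAt (ctr 4 Lc) Lc ρ' w (κ₁, (Lc : ℤ) • w + e₁) (κ₂, (Lc : ℤ) • w + e₂))
    (fun κ e (x : ↥(pbox M) × Fin (3 + 1)) => ∑' n : Site (3 + 1), symLinKerAt (ctr 4 Lc) Lc κ ((Lc : ℤ) • w + e) (x.2, translate M (x.1 : Site (3 + 1)) n))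
    (fun κ e => wrapPt M ((Lc : ℤ) • ((Lc : ℤ) • w + e) + ctr 4 Lc))
    (fun κ e => symLinKerAt (ctr 4 Lc) Lc ρ' w (κ, (Lc : ℤ) • w + e))
    (fun κ e => (perF M (dper M (symHessFFAt (ctr 4 Lc) Lc κ ((Lc : ℤ) • w + e)))).submatrix
        (fun b : ↥(pbox M) × Fin (3 + 1) => ((b.1, Sum.inl b.2) : Idx M (Fib 3)))
        (fun b : ↥(pbox M) × Fin (3 + 1) => ((b.1, Sum.inl b.2) : Idx M (Fib 3))))
    (fun κ e => (-(wM2 3 L₂ j)) • (Matrix.diagonal (fun b : ↥(pbox M) × Fin (3 + 1) => lam b.1)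
          * (perF M (dper M (symHessFFAt (ctr 4 Lc) Lc κ ((Lc : ℤ) • w + e)))).submatrix
              (fun b : ↥(pbox M) × Fin (3 + 1) => ((b.1, Sum.inl b.2) : Idx M (Fib 3)))
              (fun b : ↥(pbox M) × Fin (3 + 1) => ((b.1, Sum.inl b.2) : Idx M (Fib 3)))
        - (perF M (dper M (symHessFFAt (ctr 4 Lc) Lc κ ((Lc : ℤ) • w + e)))).submatrix
              (fun b : ↥(pbox M) × Fin (3 + 1) => ((b.1, Sum.inl b.2) : Idx M (Fib 3)))
              (fun b : ↥(pbox M) × Fin (3 + 1) => ((b.1, Sum.inl b.2) : Idx M (Fib 3)))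
          * Matrix.diagonal (fun b : ↥(pbox M) × Fin (3 + 1) => lam b.1)) + ∑ s : ↥(pbox M), lam s • (0 : Matrix (↥(pbox M) × Fin (3 + 1)) (↥(pbox M) × Fin (3 + 1)) ℝ))
    (fun _ _ _ => 0) (-(wM2 3 L₂ j)) (wM2 3 L₂ j) rfl (fun _ _ => rfl) _ (perF_dper_compH_two_ff M ρ' w)
  simp only [smul_zero, Finset.sum_const_zero, add_zero] at key
  refine Eq.trans ?_ key
  rw [smul_add]
  congr 1
  rw [Finset.smul_sum]
  refine Finset.sum_congr rfl fun κ _ => ?_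
  rw [Finset.smul_sum]
  refine Finset.sum_congr rfl fun e _ => ?_
  module

end DepthTwo

/-! ## §2 The successor step at every depth: an2 PART 33c's recursion + PART 34's split through the window bridge -/

section Succ

variable {M M' : Fin (3 + 1) → ℕ} [∀ μ, NeZero (M μ)] [∀ μ, NeZero (M' μ)] (L₂ j m : ℕ) (ρ' : Fin (3 + 1)) (w : Site (3 + 1))
  {V : Fin (3 + 1) → Site (3 + 1) → MKer (3 + 1) (Fib 3)} {Vl : Fin (3 + 1) → Site (3 + 1) → Fin (3 + 1) → Site (3 + 1) → MKer (3 + 1) (Fib 3)}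

/-- [folklore] **`def_succ` — THE WRAPPER's SHAPE AT DEPTH `m+1` FROM THE SAME SHAPE ONE DEPTH DOWN**: if the depth-`m` even mixed families at the window bonds of `(ρ′,w)`
satisfy the wrapper's row `= (−wM2)•(E_λ·Ĉ⁽ᵐ⁾_b − Ĉ⁽ᵐ⁾_b·E_λ) + Σ_s λ s • Rl s b` with ANY site-remainders `Rl`, then the depth-`(m+1)` family does with the EXPLICIT remainder
`Rs s = wM2 • Σ⁴ h • (D-word on either leg, roots `R_m`) + Σ_{b∈win} ℓ(b) • Rl s b` — an2 PART 33c `torus_compM2even_pureGauge_fst_fun_succ` + PART 34 `perF_dper_compH_succ_ff`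
through `storeyRow_eq_commutator_add_remainder_window`; iterate down to depth 1 (an2 PART 26, `Rl = 0`) for v8's `Def` at every box. -/
theorem def_succ (hM : ∀ i, M i = Lc ^ (m + 1) * M' i)
    (hV : V = fun κ u x z a c => ∑' n : Site (3 + 1),
      ((1 / 2 : ℝ) • (M2Of 3 L₂ (compMix (ctrOff (3 + 1) Lc) Lc (m + 1)) j κ u ρ' (translate M' w n)
          + sgnK (trK (M2Of 3 L₂ (compMix (ctrOff (3 + 1) Lc) Lc (m + 1)) j κ u ρ' (translate M' w n))))) x z a c)
    (hVl : ∀ (κ : Fin (3 + 1)) (e : Site (3 + 1)), Vl κ e = fun κ' u x z a c => ∑' n : Site (3 + 1),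
      ((1 / 2 : ℝ) • (M2Of 3 L₂ (compMix (ctrOff (3 + 1) Lc) Lc m) j κ' u κ (translate (fun i => Lc * M' i) ((Lc : ℤ) • w + e) n)
          + sgnK (trK (M2Of 3 L₂ (compMix (ctrOff (3 + 1) Lc) Lc m) j κ' u κ (translate (fun i => Lc * M' i) ((Lc : ℤ) • w + e) n))))) x z a c)
    (lam : ↥(pbox M) → ℝ) (Rl : ↥(pbox M) → Fin (3 + 1) → Site (3 + 1) → Matrix (↥(pbox M) × Fin (3 + 1)) (↥(pbox M) × Fin (3 + 1)) ℝ)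
    (hXl : ∀ (κ : Fin (3 + 1)) (e : Site (3 + 1)),
      (∑ b' : ↥(pbox M) × Fin (3 + 1), (∑ s : ↥(pbox M), tgrad M (b'.1, Sum.inl b'.2) s * lam s) •
          (perF M (dper M (Vl κ e b'.2 (b'.1 : Site (3 + 1))))).submatrix
            (fun b : ↥(pbox M) × Fin (3 + 1) => ((b.1, Sum.inl b.2) : Idx M (Fib 3)))
            (fun b : ↥(pbox M) × Fin (3 + 1) => ((b.1, Sum.inl b.2) : Idx M (Fib 3))))
        = (-(wM2 3 L₂ j)) • (Matrix.diagonal (fun b : ↥(pbox M) × Fin (3 + 1) => lam b.1)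
              * (perF M (dper M (compH (ctrOff (3 + 1) Lc) Lc m κ ((Lc : ℤ) • w + e)))).submatrix
                  (fun b : ↥(pbox M) × Fin (3 + 1) => ((b.1, Sum.inl b.2) : Idx M (Fib 3)))
                  (fun b : ↥(pbox M) × Fin (3 + 1) => ((b.1, Sum.inl b.2) : Idx M (Fib 3)))
            - (perF M (dper M (compH (ctrOff (3 + 1) Lc) Lc m κ ((Lc : ℤ) • w + e)))).submatrix
                  (fun b : ↥(pbox M) × Fin (3 + 1) => ((b.1, Sum.inl b.2) : Idx M (Fib 3)))
                  (fun b : ↥(pbox M) × Fin (3 + 1) => ((b.1, Sum.inl b.2) : Idx M (Fib 3)))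
              * Matrix.diagonal (fun b : ↥(pbox M) × Fin (3 + 1) => lam b.1))
          + ∑ s : ↥(pbox M), lam s • Rl s κ e) :
    (∑ b : ↥(pbox M) × Fin (3 + 1), (∑ s : ↥(pbox M), tgrad M (b.1, Sum.inl b.2) s * lam s) •
        (perF M (dper M (V b.2 (b.1 : Site (3 + 1))))).submatrix
          (fun b : ↥(pbox M) × Fin (3 + 1) => ((b.1, Sum.inl b.2) : Idx M (Fib 3)))
          (fun b : ↥(pbox M) × Fin (3 + 1) => ((b.1, Sum.inl b.2) : Idx M (Fib 3))))
      = (-(wM2 3 L₂ j)) • (Matrix.diagonal (fun b : ↥(pbox M) × Fin (3 + 1) => lam b.1)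
            * (perF M (dper M (compH (ctrOff (3 + 1) Lc) Lc (m + 1) ρ' w))).submatrix
                (fun b : ↥(pbox M) × Fin (3 + 1) => ((b.1, Sum.inl b.2) : Idx M (Fib 3)))
                (fun b : ↥(pbox M) × Fin (3 + 1) => ((b.1, Sum.inl b.2) : Idx M (Fib 3)))
          - (perF M (dper M (compH (ctrOff (3 + 1) Lc) Lc (m + 1) ρ' w))).submatrix
                (fun b : ↥(pbox M) × Fin (3 + 1) => ((b.1, Sum.inl b.2) : Idx M (Fib 3)))
                (fun b : ↥(pbox M) × Fin (3 + 1) => ((b.1, Sum.inl b.2) : Idx M (Fib 3)))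
            * Matrix.diagonal (fun b : ↥(pbox M) × Fin (3 + 1) => lam b.1))
        + ∑ s : ↥(pbox M), lam s • (wM2 3 L₂ j • ∑ κ₁ : Fin (3 + 1), ∑ e₁ ∈ offs Lc, ∑ κ₂ : Fin (3 + 1), ∑ e₂ ∈ offs Lc,
            symHessKerAt (ctr 4 Lc) Lc ρ' w (κ₁, (Lc : ℤ) • w + e₁) (κ₂, (Lc : ℤ) • w + e₂) •
              (Matrix.vecMulVec
                  (fun x : ↥(pbox M) × Fin (3 + 1) => ((if x.1 = s then (1 : ℝ) else 0)
                      - (if wrapPt M (((Lc ^ m : ℕ) : ℤ) • ((Lc : ℤ) • w + e₁) + ∑ k ∈ Finset.range m, ((Lc ^ k : ℕ) : ℤ) • ctr 4 Lc) = s then (1 : ℝ) else 0))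
                    * ∑' n : Site (3 + 1), compLinKer (fun _ => symLinKerAt (ctr 4 Lc) Lc) Lc m (x.2, translate M (x.1 : Site (3 + 1)) n) (κ₁, (Lc : ℤ) • w + e₁))
                  (fun z : ↥(pbox M) × Fin (3 + 1) => ∑' n : Site (3 + 1),
                    compLinKer (fun _ => symLinKerAt (ctr 4 Lc) Lc) Lc m (z.2, translate M (z.1 : Site (3 + 1)) n) (κ₂, (Lc : ℤ) • w + e₂))
                - Matrix.vecMulVec
                  (fun x : ↥(pbox M) × Fin (3 + 1) => ∑' n : Site (3 + 1),
                    compLinKer (fun _ => symLinKerAt (ctr 4 Lc) Lc) Lc m (x.2, translate M (x.1 : Site (3 + 1)) n) (κ₁, (Lc : ℤ) • w + e₁))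
                  (fun z : ↥(pbox M) × Fin (3 + 1) => ((if z.1 = s then (1 : ℝ) else 0)
                      - (if wrapPt M (((Lc ^ m : ℕ) : ℤ) • ((Lc : ℤ) • w + e₂) + ∑ k ∈ Finset.range m, ((Lc ^ k : ℕ) : ℤ) • ctr 4 Lc) = s then (1 : ℝ) else 0))
                    * ∑' n : Site (3 + 1), compLinKer (fun _ => symLinKerAt (ctr 4 Lc) Lc) Lc m (z.2, translate M (z.1 : Site (3 + 1)) n) (κ₂, (Lc : ℤ) • w + e₂)))
            + ∑ κ : Fin (3 + 1), ∑ e ∈ offs Lc, symLinKerAt (ctr 4 Lc) Lc ρ' w (κ, (Lc : ℤ) • w + e) • Rl s κ e) := by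
  rw [torus_compM2even_pureGauge_fst_fun_succ L₂ j m ρ' w hM hV hVl lam]
  exact storeyRow_eq_commutator_add_remainder_window (ι := ↥(pbox M) × Fin (3 + 1)) (σ := ↥(pbox M)) (K := Fin (3 + 1)) (offs Lc)
    (fun x : ↥(pbox M) × Fin (3 + 1) => x.1) lam
    (fun κ₁ e₁ κ₂ e₂ => symHessKerAt (ctr 4 Lc) Lc ρ' w (κ₁, (Lc : ℤ) • w + e₁) (κ₂, (Lc : ℤ) • w + e₂))
    (fun κ e (x : ↥(pbox M) × Fin (3 + 1)) => ∑' n : Site (3 + 1), compLinKer (fun _ => symLinKerAt (ctr 4 Lc) Lc) Lc m (x.2, translate M (x.1 : Site (3 + 1)) n) (κ, (Lc : ℤ) • w + e))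
    (fun κ e => wrapPt M (((Lc ^ m : ℕ) : ℤ) • ((Lc : ℤ) • w + e) + ∑ k ∈ Finset.range m, ((Lc ^ k : ℕ) : ℤ) • ctr 4 Lc))
    (fun κ e => symLinKerAt (ctr 4 Lc) Lc ρ' w (κ, (Lc : ℤ) • w + e))
    (fun κ e => (perF M (dper M (compH (ctrOff (3 + 1) Lc) Lc m κ ((Lc : ℤ) • w + e)))).submatrix
        (fun b : ↥(pbox M) × Fin (3 + 1) => ((b.1, Sum.inl b.2) : Idx M (Fib 3)))
        (fun b : ↥(pbox M) × Fin (3 + 1) => ((b.1, Sum.inl b.2) : Idx M (Fib 3))))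
    _ (fun s κ e => Rl s κ e) (-(wM2 3 L₂ j)) (wM2 3 L₂ j) rfl hXl _ (perF_dper_compH_succ_ff M m ρ' w)

end Succ


end Summit.QuantumFields.BalabanUV.Beta.FP.TowerK2bStoreyBridgeTwo

end
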